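import Literature.Analysis.FluidPDE.LeiZhang2011RegularityOfSwirlStep
import Literature.Analysis.FluidPDE.LerayHopfBoundedContinuation
import Literature.Analysis.FluidPDE.LerayHopfRegularIntervalClassical
import Literature.Analysis.FluidPDE.LerayHopfH1Test
import Literature.Analysis.FluidPDE.SchefferSingularTimes
import HarnessLib

/-!
# Lei–Zhang 2011, Theorem 1.4 for Leray–Hopf weak solutions, conditional on the swirl step
# (and with the bound on `r v^θ` assumed on the slab)

Analysis/FluidPDE **proofs file** (theorems only: no definitions, no named facts, no `sorry`) on
the discharge path of the named fact
`Literature.Analysis.FluidPDE.LeiZhang2011_regularity_bmoStream` (Z. Lei, Q. S. Zhang,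
J. Funct. Anal. 261 (2011) = arXiv:1011.5066, **Theorem 1.4**, stated for *suitable weak
solutions* with `L²` datum). The classical-frame theorem
`LeiZhang2011_regularity_classical_of_swirlStep` (no blow-up for classical solutions bounded on
earlier slabs) is transported here to the Leray–Hopf frame of the printed statement through
Leray's structure theory, entirely from proved tree results:

* a Leray–Hopf solution is `H¹`-regular on `(0, T]` as soon as `limsup_{t → β⁻} ‖u(t)‖_{H¹} < ∞`
  at the right end of every interval of `H¹`-regularity (`leray_continuation_H1_holds`,
  Cheskidov–Shvydkoy 2010 Thm. 2.4), and is then classical on `(0, T]`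
  (`classical_of_isH1RegularOn` with `ladyzhenskaya_prodi_serrin_holds`);
* that `limsup` is finite when the solution is essentially bounded near `β`
  (`limsup_eH1NormSq_lt_top_of_ae_bound_near`, RRS 2016 Thm. 8.17);
* on an interval of regularity the solution is classical from every good time on and bounded on
  compact sub-intervals (`exists_classical_Ioo_of_isH1RegularOn`,
  `exists_ae_bound_Icc_of_isH1RegularOn`), axisymmetry, the bound on `Γ` and the `BMO` stream
  class pass to the continuous representative, and the classical-frame theorem bounds it up to
  `β` (`ae_bound_near_of_isH1RegularOn_of_swirlStep`).

Main results: `LeiZhang2011_regularity_lerayHopf_of_swirlStep` (a classical representative on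
`(0, T]`) and `LeiZhang2011_regularity_bmoStream_of_swirlStep_of_swirlBound` — the printed
Theorem 1.4 in the shape of the named fact, **conditional on** (i) the swirl step (Theorem 1.1 of
the paper for the blow-up limit) and (ii) the bound `|r v^θ| ≤ C` on the whole slab `(0, T)`
(the fact assumes it at `t = 0` only; the printed proof invokes "the assumption on initial value
and the maximum principle", p. 12, i.e. a maximum principle for `Γ` along the weak solution,
which is proved in the tree for classical solutions only, `abs_swirl_le_of_classical`).

## References

* Z. Lei, Q. S. Zhang, J. Funct. Anal. 261 (2011) = arXiv:1011.5066: Thm. 1.4 and its proof §4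
  (pp. 4, 12–13). [LeiZhang2011]
* J. C. Robinson, J. L. Rodrigo, W. Sadowski, *The Three-Dimensional Navier–Stokes Equations*,
  CUP (2016), §8.1, Thms. 8.14, 8.17. [RobinsonRodrigoSadowski2016]
* A. Cheskidov, R. Shvydkoy, Arch. Ration. Mech. Anal. 195 (2010), Thm. 2.4. [CheskidovShvydkoy2010]
-/

noncomputable section

open MeasureTheory Set Function Filter Topology TopologicalSpace Metric
open scoped InnerProductSpace RealInnerProductSpace NNReal

namespace Literature.Analysis.FluidPDE

open Literature.Analysis.FunctionSpaces SereginSverak2009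

/-! ### Transport of the hypotheses to a continuous representative -/

/-- Axisymmetry passes from a slice to a continuous a.e.-representative (rotations preserve
Lebesgue measure; continuous a.e.-equal fields are equal). [folklore] -/
theorem IsAxisymmetric.of_ae_eq {w V : EuclideanSpace ℝ (Fin 3) → EuclideanSpace ℝ (Fin 3)}
    (haxi : IsAxisymmetric w) (hae : w =ᵐ[volume] V) (hV : Continuous V) : IsAxisymmetric V := by
  intro θ
  have hmp : MeasurePreserving (rotZ θ) volume volume := (rotZLIE θ).measurePreserving
  have h1 : (fun y => V (rotZ θ y)) =ᵐ[volume] fun y => w (rotZ θ y) :=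
    hmp.quasiMeasurePreserving.ae_eq_comp hae.symm
  have h2 : (fun y => w (rotZ θ y)) = fun y => rotZ θ (w y) := funext (haxi θ)
  have h3 : (fun y => rotZ θ (w y)) =ᵐ[volume] fun y => rotZ θ (V y) :=
    hae.mono fun y hy => by simp only [hy]
  have h4 : (fun y => V (rotZ θ y)) = fun y => rotZ θ (V y) :=
    eq_of_ae_eq_of_continuous (hV.comp (rotZL θ).continuous) ((rotZL θ).continuous.comp hV)
      ((h1.trans (h2 ▸ h3)))
  exact fun y => congrFun h4 y

/-- An a.e. bound on `Γ = r v^θ` passes to every point of a continuous a.e.-representative.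
[folklore] -/
theorem forall_abs_swirl_le_of_ae {w V : EuclideanSpace ℝ (Fin 3) → EuclideanSpace ℝ (Fin 3)}
    {C : ℝ} (h : ∀ᵐ x ∂volume, |swirl w x| ≤ C) (hae : w =ᵐ[volume] V) (hV : Continuous V) :
    ∀ x, |swirl V x| ≤ C := by
  have hc : Continuous fun x => swirl V x := by
    have h0 : Continuous fun x : EuclideanSpace ℝ (Fin 3) => V x 0 :=
      (PiLp.continuous_apply 2 _ 0).comp hV
    have h1 : Continuous fun x : EuclideanSpace ℝ (Fin 3) => V x 1 :=
      (PiLp.continuous_apply 2 _ 1).comp hV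
    exact ((PiLp.continuous_apply 2 _ 0).mul h1).sub ((PiLp.continuous_apply 2 _ 1).mul h0)
  have hae' : ∀ᵐ x ∂volume, ‖swirl V x‖ ≤ C := by
    filter_upwards [h, hae] with x hx hx'
    rw [Real.norm_eq_abs]
    have : swirl V x = swirl w x := by simp only [swirl, hx']
    rwa [this]
  intro x
  have := forall_norm_le_of_ae_bound hc hae' x
  rwa [Real.norm_eq_abs] at this

/-- The `BMO` stream class passes to a.e.-representatives of the slices. [folklore] -/
theorem HasBMOStreamFunctionOn.congr_ae {S : Set ℝ}
    {u V B : ℝ → EuclideanSpace ℝ (Fin 3) → EuclideanSpace ℝ (Fin 3)} {K : ℝ≥0}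
    (h : HasBMOStreamFunctionOn S u B K) (hae : ∀ t ∈ S, u t =ᵐ[volume] V t) :
    HasBMOStreamFunctionOn S V B K := fun t ht =>
  ⟨(h t ht).1, (h t ht).2.1.trans (hae t ht), (h t ht).2.2⟩

/-! ### The bound near the right end of an interval of regularity -/

/-- **The blow-up criterion on an interval of regularity.** Let `u` be Leray–Hopf on
`ℝ³ × [0, T)` (`ν = 1`) with axisymmetric slices, `|Γ| ≤ C₁` a.e. on every slice of `(0, T)`
and a stream function with `BMO` slices on `(0, T)`, and assume the swirl step. If `u` is
`H¹`-regular on `(α, β)`, `0 ≤ α < β ≤ T`, then `u` is essentially bounded on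
`(β − δ, β) × ℝ³` for some `δ > 0`: from a good time `s ∈ (α, β)` the solution is classical on
`(s, β)` (`exists_classical_Ioo_of_isH1RegularOn`), bounded on the compact sub-slabs
(`exists_ae_bound_Icc_of_isH1RegularOn`), axisymmetric with `|Γ| ≤ C₁` and the same stream
functions (transport to the continuous representative), so
`LeiZhang2011_regularity_classical_of_swirlStep` (applied from `s' = (s + β)/2`) bounds it up
to `β`. [cite: LeiZhang2011, Thm. 1.4, proof §4 (arXiv p. 12)] -/
theorem ae_bound_near_of_isH1RegularOn_of_swirlStep
    (hstep : ∀ (v : ℝ → EuclideanSpace ℝ (Fin 3) → EuclideanSpace ℝ (Fin 3)) (C : ℝ),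
      IsBoundedWeakNSSolutionOn (Iio 0) isOpen_Iio 1 v → Continuous (uncurry v) →
      (∀ t < 0, IsAxisymmetric (v t)) → (∀ t < 0, ∀ x, |swirl (v t) x| ≤ C) →
      (∀ t < 0, ∃ Bt : EuclideanSpace ℝ (Fin 3) → EuclideanSpace ℝ (Fin 3),
        LocallyIntegrable Bt volume ∧ eBMOSeminormVec Bt < ⊤ ∧
        ∀ (φ : EuclideanSpace ℝ (Fin 3) → ℝ) (e : EuclideanSpace ℝ (Fin 3)),
          ContDiff ℝ 1 φ → HasCompactSupport φ →
            ∫ x, φ x * ⟪v t x, e⟫ = ∫ x, ⟪cross (Bt x) (gradient φ x), e⟫) →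
      ∀ t < 0, HasNoSwirl (v t))
    {T : ℝ} {u₀ : EuclideanSpace ℝ (Fin 3) → EuclideanSpace ℝ (Fin 3)}
    {u : ℝ → EuclideanSpace ℝ (Fin 3) → EuclideanSpace ℝ (Fin 3)}
    (hLH : IsLerayHopfOn T 1 0 u₀ u) (haxi : ∀ t ∈ Ioo 0 T, IsAxisymmetric (u t))
    {C₁ : ℝ} (hΓ : ∀ t ∈ Ioo 0 T, ∀ᵐ x ∂volume, |swirl (u t) x| ≤ C₁)
    {Bs : ℝ → EuclideanSpace ℝ (Fin 3) → EuclideanSpace ℝ (Fin 3)} {Kb : ℝ≥0}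
    (hBs : HasBMOStreamFunctionOn (Ioo 0 T) u Bs Kb)
    {α β : ℝ} (hα : 0 ≤ α) (hαβ : α < β) (hβ : β ≤ T) (hreg : IsH1RegularOn (Ioo α β) u) :
    ∃ δ M : ℝ, 0 < δ ∧ ∀ t ∈ Ioo (β - δ) β, ∀ᵐ x ∂volume, ‖u t x‖ ≤ M := by
  -- a good time and the classical representative on `(s, β)`
  obtain ⟨s, hs, hLHs⟩ := hLH.exists_isLerayHopfOn_restart_Ioo zero_le_one hα hαβ hβ
  obtain ⟨V, P, hV, hrep⟩ := exists_classical_Ioo_of_isH1RegularOn one_pos hβ hreg hs hLHs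
  have h0s : 0 < s := hα.trans_lt hs.1
  have hmemT : ∀ t ∈ Ioo s β, t ∈ Ioo 0 T := fun t ht => ⟨h0s.trans ht.1, ht.2.trans_le hβ⟩
  have hVc : ∀ t ∈ Ioo s β, Continuous (V t) := fun t ht => (hV.contDiff_velocity ht).continuous
  -- transport of the hypotheses to `V`
  have hVaxi : ∀ t ∈ Ioo s β, IsAxisymmetric (V t) := fun t ht =>
    (haxi t (hmemT t ht)).of_ae_eq (hrep t ht) (hVc t ht)
  have hVΓ : ∀ t ∈ Ioo s β, ∀ x, |swirl (V t) x| ≤ C₁ := fun t ht =>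
    forall_abs_swirl_le_of_ae (hΓ t (hmemT t ht)) (hrep t ht) (hVc t ht)
  have hVB : HasBMOStreamFunctionOn (Ioo s β) V Bs Kb :=
    (hBs.mono fun t ht => hmemT t ht).congr_ae hrep
  have hVnorm : ∀ t ∈ Ioo s β, ∀ M : ℝ, (∀ᵐ x ∂volume, ‖u t x‖ ≤ M) → ∀ x, ‖V t x‖ ≤ M := by
    intro t ht M hM
    refine forall_norm_le_of_ae_bound (hVc t ht) ?_
    filter_upwards [hM, hrep t ht] with x hx hx'
    rwa [hx'] at hx
  -- the starting time `s' = (s + β)/2` and the bounds on the earlier slabs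
  set s' : ℝ := (s + β) / 2 with hs'
  have hss' : s < s' := by rw [hs']; linarith [hs.2]
  have hs'β : s' < β := by rw [hs']; linarith [hs.2]
  have hVbd : ∀ T' < β - s', ∃ M : ℝ, ∀ t ∈ Ioo 0 T', ∀ x, ‖V (t + s') x‖ ≤ M := by
    intro T' hT'
    rcases le_or_gt T' 0 with hle | hpos
    · exact ⟨0, fun t ht x => absurd (ht.1.trans ht.2) (not_lt.2 hle)⟩
    obtain ⟨M, hM⟩ := exists_ae_bound_Icc_of_isH1RegularOn one_pos hLH hα hβ hreg
      (a := s') (b := s' + T') (hs.1.trans hss') (by linarith)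
    refine ⟨M, fun t ht x => ?_⟩
    have hts : t + s' ∈ Ioo s β := ⟨by linarith [ht.1], by linarith [ht.2]⟩
    exact hVnorm _ hts M (hM (t + s') ⟨by linarith [ht.1], by linarith [ht.2]⟩) x
  -- the shifted classical solution on `(0, β - s')`
  have hVs : IsClassicalNSSolutionOn (Ioo 0 (β - s')) 1 0 (fun t => V (t + s'))
      (fun t => P (t + s')) := by
    have h := hV.comp_add_right s'
    have h0 : (fun t => (0 : ℝ → EuclideanSpace ℝ (Fin 3) → EuclideanSpace ℝ (Fin 3)) (t + s')) =
        0 := rfl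
    rw [h0] at h
    exact h.mono (fun t ht => ⟨by simp only; linarith [ht.1], by simp only; linarith [ht.2]⟩)
      (uniqueDiffOn_Ioo _ _)
  have hmem' : ∀ t ∈ Ioo 0 (β - s'), t + s' ∈ Ioo s β := fun t ht =>
    ⟨by linarith [ht.1], by linarith [ht.2]⟩
  obtain ⟨M, hM⟩ := LeiZhang2011_regularity_classical_of_swirlStep hstep (sub_pos.2 hs'β) hVs
    hVbd (fun t ht => hVaxi (t + s') (hmem' t ht)) ⟨C₁, fun t ht x => hVΓ (t + s') (hmem' t ht) x⟩
    ⟨fun t => Bs (t + s'), Kb, fun t ht => hVB (t + s') (hmem' t ht)⟩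
  -- back to `u` on `(s', β)`
  refine ⟨β - s', M, sub_pos.2 hs'β, fun t ht => ?_⟩
  have ht' : t ∈ Ioo s β := ⟨by linarith [ht.1], ht.2⟩
  have h1 := hM (t - s') ⟨by linarith [ht.1], by linarith [ht.2]⟩
  simp only [sub_add_cancel] at h1
  filter_upwards [hrep t ht'] with x hx
  rw [hx]
  exact h1 x

/-! ### Theorem 1.4 for Leray–Hopf solutions, conditional on the swirl step -/

/-- **Lei–Zhang 2011, Theorem 1.4 for Leray–Hopf weak solutions (conditional on the swirl step;
`Γ` bounded on the slab).** Let `u` be a Leray–Hopf weak solution of the unforced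
Navier–Stokes system (`ν = 1`) on `ℝ³ × [0, T)` with axisymmetric slices, `|r u^θ| ≤ C₁` a.e.
on every slice of `(0, T)`, and a stream function with `BMO` slices on `(0, T)`
(`HasBMOStreamFunctionOn`). Assume the swirl step (Theorem 1.1 of the paper for the blow-up
limit class). Then `u` has a classical representative on `(0, T]`: a classical solution
`(V, P)` on the time set `(0, T]` with `u(t) = V(t)` a.e. for every `t ∈ (0, T]` ("`v` is
smooth in `ℝ³ × (0, T]`"). Proof: Leray's continuation theorem `leray_continuation_H1_holds`
with the hypothesis supplied by `ae_bound_near_of_isH1RegularOn_of_swirlStep` and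
`limsup_eH1NormSq_lt_top_of_ae_bound_near`, then `classical_of_isH1RegularOn`
(`ladyzhenskaya_prodi_serrin_holds`). [cite: LeiZhang2011, Thm. 1.4 and proof §4 (arXiv pp. 4, 12–13)] -/
theorem LeiZhang2011_regularity_lerayHopf_of_swirlStep
    (hstep : ∀ (v : ℝ → EuclideanSpace ℝ (Fin 3) → EuclideanSpace ℝ (Fin 3)) (C : ℝ),
      IsBoundedWeakNSSolutionOn (Iio 0) isOpen_Iio 1 v → Continuous (uncurry v) →
      (∀ t < 0, IsAxisymmetric (v t)) → (∀ t < 0, ∀ x, |swirl (v t) x| ≤ C) →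
      (∀ t < 0, ∃ Bt : EuclideanSpace ℝ (Fin 3) → EuclideanSpace ℝ (Fin 3),
        LocallyIntegrable Bt volume ∧ eBMOSeminormVec Bt < ⊤ ∧
        ∀ (φ : EuclideanSpace ℝ (Fin 3) → ℝ) (e : EuclideanSpace ℝ (Fin 3)),
          ContDiff ℝ 1 φ → HasCompactSupport φ →
            ∫ x, φ x * ⟪v t x, e⟫ = ∫ x, ⟪cross (Bt x) (gradient φ x), e⟫) →
      ∀ t < 0, HasNoSwirl (v t))
    {T : ℝ} {u₀ : EuclideanSpace ℝ (Fin 3) → EuclideanSpace ℝ (Fin 3)}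
    {u : ℝ → EuclideanSpace ℝ (Fin 3) → EuclideanSpace ℝ (Fin 3)} (hT : 0 < T)
    (hLH : IsLerayHopfOn T 1 0 u₀ u) (haxi : ∀ t ∈ Ioo 0 T, IsAxisymmetric (u t))
    (hΓ : ∃ C₁ : ℝ, ∀ t ∈ Ioo 0 T, ∀ᵐ x ∂volume, |swirl (u t) x| ≤ C₁)
    (hB : ∃ (B : ℝ → EuclideanSpace ℝ (Fin 3) → EuclideanSpace ℝ (Fin 3)) (K : ℝ≥0),
      HasBMOStreamFunctionOn (Ioo 0 T) u B K) :
    ∃ (V : ℝ → EuclideanSpace ℝ (Fin 3) → EuclideanSpace ℝ (Fin 3))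
      (P : ℝ → EuclideanSpace ℝ (Fin 3) → ℝ),
      IsClassicalNSSolutionOn (Ioc 0 T) 1 0 V P ∧ ∀ t ∈ Ioc 0 T, u t =ᵐ[volume] V t := by
  obtain ⟨C₁, hC₁⟩ := hΓ
  obtain ⟨Bs, Kb, hBs⟩ := hB
  have hhyp : ∀ α β : ℝ, 0 ≤ α → α < β → β ≤ T → IsH1RegularOn (Ioo α β) u →
      limsup (fun t => eH1NormSq (u t)) (𝓝[<] β) < ⊤ := by
    intro α β hα hαβ hβ hreg
    obtain ⟨δ, M, hδ, hbd⟩ :=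
      ae_bound_near_of_isH1RegularOn_of_swirlStep hstep hLH haxi hC₁ hBs hα hαβ hβ hreg
    exact limsup_eH1NormSq_lt_top_of_ae_bound_near one_pos hLH hα hαβ hβ hreg hδ hbd
  have hreg : IsH1RegularOn (Ioc 0 T) u := leray_continuation_H1_holds 1 T one_pos hT u₀ u hLH hhyp
  exact classical_of_isH1RegularOn ladyzhenskaya_prodi_serrin_holds one_pos hT hLH hreg

/-- **Lei–Zhang 2011, Theorem 1.4 in the shape of the named fact
`LeiZhang2011_regularity_bmoStream`, conditional on the swirl step and with the bound on
`Γ = r v^θ` assumed on the slab `(0, T)` (a.e. on each slice) instead of at the initial time.**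
For a Leray–Hopf weak solution `v` on `ℝ³ × [0, T)` from `v 0` with axisymmetric slices, such a
bound, and a stream function with `BMO` slices: there is `w`, smooth on `(0, T] × ℝ³`, with
`v = w` a.e. on `(0, T) × ℝ³` (the classical representative of
`LeiZhang2011_regularity_lerayHopf_of_swirlStep`; slice-wise a.e. equality is upgraded to the
slab by `uncurry_ae_eq_restrict_prod_of_forall_slice_ae_eq`). The hypothesis that `(v, p)` is a
*suitable* weak solution is not needed for this implication. What separates this theorem from
the named fact: (i) the swirl step `hstep` = Theorem 1.1 of the paper (Hölder continuity of `Γ`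
at the axis, §§2–3), (ii) the passage from `|Γ(·, 0)| ≤ C` to `|Γ| ≤ C` on the slab ("by the
assumption on initial value and the maximum principle", p. 12), proved in the tree for classical
solutions (`abs_swirl_le_of_classical`) but not along a general Leray–Hopf solution. [cite: LeiZhang2011, Thm. 1.4 (arXiv p. 4) and proof §4 (pp. 12–13)] -/
theorem LeiZhang2011_regularity_bmoStream_of_swirlStep_of_swirlBound
    (hstep : ∀ (v : ℝ → EuclideanSpace ℝ (Fin 3) → EuclideanSpace ℝ (Fin 3)) (C : ℝ),
      IsBoundedWeakNSSolutionOn (Iio 0) isOpen_Iio 1 v → Continuous (uncurry v) →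
      (∀ t < 0, IsAxisymmetric (v t)) → (∀ t < 0, ∀ x, |swirl (v t) x| ≤ C) →
      (∀ t < 0, ∃ Bt : EuclideanSpace ℝ (Fin 3) → EuclideanSpace ℝ (Fin 3),
        LocallyIntegrable Bt volume ∧ eBMOSeminormVec Bt < ⊤ ∧
        ∀ (φ : EuclideanSpace ℝ (Fin 3) → ℝ) (e : EuclideanSpace ℝ (Fin 3)),
          ContDiff ℝ 1 φ → HasCompactSupport φ →
            ∫ x, φ x * ⟪v t x, e⟫ = ∫ x, ⟪cross (Bt x) (gradient φ x), e⟫) →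
      ∀ t < 0, HasNoSwirl (v t))
    {T : ℝ} (hT : 0 < T) {v : ℝ → EuclideanSpace ℝ (Fin 3) → EuclideanSpace ℝ (Fin 3)}
    (hLH : IsLerayHopfOn T 1 0 (v 0) v) (haxi : ∀ t ∈ Ioo 0 T, IsAxisymmetric (v t))
    (hΓ : ∃ C : ℝ, ∀ t ∈ Ioo 0 T, ∀ᵐ x ∂volume, |swirl (v t) x| ≤ C)
    (hB : ∃ (B : ℝ → EuclideanSpace ℝ (Fin 3) → EuclideanSpace ℝ (Fin 3)) (C : ℝ≥0),
      HasBMOStreamFunctionOn (Ioo 0 T) v B C) :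
    ∃ w : ℝ → EuclideanSpace ℝ (Fin 3) → EuclideanSpace ℝ (Fin 3),
      IsSmoothSpaceTimeOn (Ioc 0 T) w ∧
        uncurry v =ᵐ[volume.restrict (Ioo 0 T ×ˢ univ)] uncurry w := by
  obtain ⟨V, P, hV, hrep⟩ := LeiZhang2011_regularity_lerayHopf_of_swirlStep hstep hT hLH haxi hΓ hB
  refine ⟨V, hV.smooth_velocity, ?_⟩
  refine uncurry_ae_eq_restrict_prod_of_forall_slice_ae_eq measurableSet_Ioo
    (fun t ht => hrep t ⟨ht.1, ht.2.le⟩) hLH.weak.1 ?_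
  exact (hV.smooth_velocity.continuousOn.mono (prod_mono Ioo_subset_Ioc_self Subset.rfl)
    ).aestronglyMeasurable (measurableSet_Ioo.prod MeasurableSet.univ)

end Literature.Analysis.FluidPDE
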